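import Mathlib

/-!
# `FidelityWitnesses.FidelityGapTwoSix`, line `closure-transfer` — stub `stub_coneClosure`

Closure criterion for a complex cone (crux `stmt-MatrixMultiplication-4957`, registered stub
`stub_coneClosure` of `Cruxes/FidelityGapTwoSix/Lines/closure-transfer.lean`): if a set `C` of
`3`-tensors over `ℂ` (finite format) is stable under all complex scalings and contains, for every
`ε > 0`, a tensor whose sesquilinear overlap with `T` exceeds `(1 - ε)·‖S‖²·‖T‖²`, then `T` lies in
the closure of `C`.  The proof is square-root free: project `T` onto the complex line through a
near-optimal `S` (which stays in the cone); the Bessel identity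
`‖S‖² · Σ‖(z/‖S‖²)•S − T‖² = ‖S‖²‖T‖² − |z|²` (`z = Σ conj S · T`) makes the `ℓ²`-distance, hence
every coordinate distance, small.
-/

namespace Summit.MatrixMultiplication.MatrixMultiplication.Theorems

open scoped BigOperators ComplexConjugate

/-- **Projection onto a complex line, `ℓ²` form.**  For finitely indexed complex vectors `x, y`
with `(1 - ε)·Σ‖xᵢ‖²·Σ‖yᵢ‖² < |Σ conj(xᵢ)·yᵢ|²`, some complex multiple of `x` is `ε·Σ‖yᵢ‖²`-close
to `y` in squared `ℓ²` distance (take the orthogonal projection `(z/Σ‖xᵢ‖²)·x`,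
`z = Σ conj(xᵢ)·yᵢ`; the hypothesis forces `x ≠ 0`). [folklore] -/
theorem exists_sum_norm_sq_mul_sub_lt {α : Type*} [Fintype α] (x y : α → ℂ) (ε : ℝ)
    (h : (1 - ε) * (∑ i, ‖x i‖ ^ 2) * (∑ i, ‖y i‖ ^ 2) < ‖∑ i, conj (x i) * y i‖ ^ 2) :
    ∃ c : ℂ, ∑ i, ‖c * x i - y i‖ ^ 2 < ε * ∑ i, ‖y i‖ ^ 2 := by
  obtain ⟨s2, hs2⟩ : ∃ s2 : ℝ, (∑ i, ‖x i‖ ^ 2) = s2 := ⟨_, rfl⟩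
  obtain ⟨t2, ht2⟩ : ∃ t2 : ℝ, (∑ i, ‖y i‖ ^ 2) = t2 := ⟨_, rfl⟩
  obtain ⟨z, hz⟩ : ∃ z : ℂ, (∑ i, conj (x i) * y i) = z := ⟨_, rfl⟩
  rw [hs2, ht2, hz] at h
  rw [ht2]
  -- the near-optimal vector is non-zero
  have hs2_nonneg : 0 ≤ s2 := hs2 ▸ Finset.sum_nonneg fun i _ => by positivity
  have hs2_pos : 0 < s2 := by
    rcases hs2_nonneg.eq_or_lt with heq | hlt
    · exfalso
      have hx : ∀ i, x i = 0 := by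
        intro i
        have hsum : (∑ i, ‖x i‖ ^ 2) = 0 := hs2.trans heq.symm
        have := (Finset.sum_eq_zero_iff_of_nonneg (fun i _ => by positivity)).1 hsum i
          (Finset.mem_univ _)
        simpa using this
      have hz0 : z = 0 := by
        rw [← hz]
        exact Finset.sum_eq_zero fun i _ => by simp [hx i]
      rw [hz0, ← heq] at h
      simp at h
    · exact hlt
  -- Bessel identity for the projection coefficient `c = z / s2`
  refine ⟨z / (s2 : ℂ), ?_⟩
  have key : ∀ i, ‖z / (s2 : ℂ) * x i - y i‖ ^ 2
      = ‖z‖ ^ 2 / s2 ^ 2 * ‖x i‖ ^ 2 + ‖y i‖ ^ 2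
          - 2 * (z / (s2 : ℂ) * (x i * conj (y i))).re := by
    intro i
    rw [Complex.sq_norm, Complex.sq_norm, Complex.sq_norm, Complex.sq_norm, Complex.normSq_sub,
      Complex.normSq_mul, Complex.normSq_div, mul_assoc]
    congr 2
    rw [Complex.normSq_ofReal]
    ring
  have hw : (∑ i, x i * conj (y i)) = conj z := by
    rw [← hz, map_sum]
    exact Finset.sum_congr rfl fun i _ => by simp [mul_comm]
  have hre : (z / (s2 : ℂ) * conj z).re = ‖z‖ ^ 2 / s2 := by
    rw [div_mul_eq_mul_div, Complex.mul_conj', ← Complex.ofReal_pow, ← Complex.ofReal_div,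
      Complex.ofReal_re]
  have hsum : (∑ i, ‖z / (s2 : ℂ) * x i - y i‖ ^ 2) = ‖z‖ ^ 2 / s2 ^ 2 * s2 + t2
      - 2 * (‖z‖ ^ 2 / s2) := by
    rw [Finset.sum_congr rfl fun i _ => key i, Finset.sum_sub_distrib, Finset.sum_add_distrib,
      ← Finset.mul_sum, ← Finset.mul_sum, ← Complex.re_sum, ← Finset.mul_sum, hw, hre, hs2, ht2]
  rw [hsum]
  have h1 : (1 - ε) * t2 < ‖z‖ ^ 2 / s2 := by
    rw [lt_div_iff₀ hs2_pos]
    linarith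
  have h2 : ‖z‖ ^ 2 / s2 ^ 2 * s2 = ‖z‖ ^ 2 / s2 := by
    field_simp
  rw [h2]
  linarith

/-- **Stub `stub_coneClosure` of line `closure-transfer` (crux `FidelityWitnesses.FidelityGapTwoSix`,
stmt-MatrixMultiplication-4957) — closure criterion for a complex cone.**  Finite format
`ι × κ × μ`; `C` any set of tensors stable under all complex scalings `S ↦ c • S`; `T` any tensor.  If
for every `ε > 0` some `S ∈ C` has sesquilinear overlap `|⟨S,T⟩|² > (1 − ε)·‖S‖²·‖T‖²` (coordinate
`ℓ²` sums), then `T` is a limit of elements of `C` in the product (sup-metric) topology of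
`ι → κ → μ → ℂ`: project `T` onto the line `ℂ·S` (`exists_sum_norm_sq_mul_sub_lt`), which stays in
the cone, and bound every coordinate by the `ℓ²` distance. [folklore] -/
theorem stub_coneClosure {ι κ μ : Type} [Fintype ι] [Fintype κ] [Fintype μ]
    (C : Set (ι → κ → μ → ℂ)) (hC : ∀ (c : ℂ) (S : ι → κ → μ → ℂ), S ∈ C → c • S ∈ C)
    (T : ι → κ → μ → ℂ)
    (h : ∀ ε : ℝ, 0 < ε → ∃ S ∈ C,
      (1 - ε) * (∑ a, ∑ b, ∑ c, ‖S a b c‖ ^ 2) * (∑ a, ∑ b, ∑ c, ‖T a b c‖ ^ 2) <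
        ‖∑ a, ∑ b, ∑ c, (starRingEnd ℂ) (S a b c) * T a b c‖ ^ 2) :
    T ∈ closure C := by
  rw [Metric.mem_closure_iff]
  intro δ hδ
  -- squared `ℓ²` norm of `T`, and the tolerance fed to the hypothesis
  obtain ⟨t2, ht2⟩ : ∃ t2 : ℝ, (∑ a, ∑ b, ∑ c, ‖T a b c‖ ^ 2) = t2 := ⟨_, rfl⟩
  have ht2_nonneg : 0 ≤ t2 := ht2 ▸ Finset.sum_nonneg fun a _ =>
    Finset.sum_nonneg fun b _ => Finset.sum_nonneg fun c _ => by positivity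
  have hε : 0 < δ ^ 2 / (t2 + 1) := by positivity
  obtain ⟨S, hSC, hlt⟩ := h _ hε
  -- flatten the format to a single finite index and project
  obtain ⟨c₀, hc₀⟩ := exists_sum_norm_sq_mul_sub_lt
    (fun p : ι × κ × μ => S p.1 p.2.1 p.2.2) (fun p : ι × κ × μ => T p.1 p.2.1 p.2.2)
    (δ ^ 2 / (t2 + 1)) (by simpa only [Fintype.sum_prod_type] using hlt)
  have hflatT : (∑ p : ι × κ × μ, ‖T p.1 p.2.1 p.2.2‖ ^ 2) = t2 := by
    rw [← ht2]
    simp only [Fintype.sum_prod_type]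
  rw [hflatT] at hc₀
  -- the squared `ℓ²` distance is `< δ²`
  have hdist2 : (∑ p : ι × κ × μ, ‖c₀ * S p.1 p.2.1 p.2.2 - T p.1 p.2.1 p.2.2‖ ^ 2) < δ ^ 2 := by
    refine hc₀.trans_le ?_
    rw [div_mul_eq_mul_div, div_le_iff₀ (by positivity)]
    nlinarith [sq_nonneg δ]
  refine ⟨c₀ • S, hC c₀ S hSC, ?_⟩
  refine (dist_pi_lt_iff hδ).2 fun a => (dist_pi_lt_iff hδ).2 fun b => (dist_pi_lt_iff hδ).2
    fun c => ?_
  rw [dist_comm, dist_eq_norm]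
  show ‖c₀ * S a b c - T a b c‖ < δ
  refine lt_of_pow_lt_pow_left₀ 2 hδ.le (lt_of_le_of_lt ?_ hdist2)
  exact Finset.single_le_sum (f := fun p : ι × κ × μ => ‖c₀ * S p.1 p.2.1 p.2.2 - T p.1 p.2.1 p.2.2‖ ^ 2)
    (fun p _ => by positivity) (Finset.mem_univ (a, b, c))

end Summit.MatrixMultiplication.MatrixMultiplication.Theorems
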